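import Literature.NumberTheory.QuadraticFields.ReducedQuadraticIrrationalsCycle
import Mathlib.Algebra.Order.Round
import HarnessLib

/-!
# The modules `ℤ + φℤ` of quadratic irrationals: steps, normalisation and Gauss reduction

Topic `NumberTheory/QuadraticFields`; continues `ReducedQuadraticIrrationalsCycle.lean`.
Theorem-and-definition file (no named facts). To a quotient `x = (P, Q)` we attach Jozsa's
fractional ideal `J(x) = ℤ + φℤ ⊂ ℝ`, `φ = (P + √D)/Q` (Jozsa 2003, §6.1–6.2: the ideals
`ℤ + ((b + √D)/2a)ℤ`; Jacobson–Williams §5.1: `𝔞 = [Q/r, (P + √D)/r] = (Q/r)·J`), and prove the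
module identities behind the infrastructure's baby steps and reduction:

* `jmod x` (an additive subgroup of `ℝ`), `mem_jmod_iff`;
* `stepWith x q` — the continued-fraction step with an arbitrary integer quotient `q`
  (`step x = stepWith x ⌊φ⌋`), `val_stepWith : φ' = 1/(φ − q)` and
  **`mem_jmod_stepWith_iff : J(x') = φ' · J(x)`** (JW (5.4)–(5.5): `ρ(𝔞) = ψ 𝔞`; Jozsa §6.2);
* `flipQ` (`(P, −Q)`: `φ ↦ −φ`, same module) and `shiftP` (`P ↦ P + kQ`: `φ ↦ φ + k`, same module);
* `normalize` — for `0 < Q < √D` the representative with `√D − Q < P < √D` is **reduced**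
  (`isReduced_normalize`; JW Thm. 5.9: `N(𝔞) < √Δ/2 ⇒ 𝔞` reduced; Jozsa §6.1 Cor. 1);
* `gaussStep` — one step with the nearest-integer quotient, made positive: for `Q ≥ 2√D` it
  divides `Q` by at least `4` (`four_mul_gaussStep_Q_le`), and for `√D ≤ Q` it reaches `Q' < √D`
  (`gaussStep_Q_sq_lt`) (Jozsa §6.2 Prop. 21: "if `I_i` is not reduced then `a_i < a_{i−1}/2`";
  Gauss/Lagrange reduction), again with `J(x') = |φ'| · J(x)` up to sign (`mem_jmod_gaussStep_iff`).

## References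

* R. Jozsa, *Notes on Hallgren's efficient quantum algorithm for solving Pell's equation*,
  arXiv:quant-ph/0302134 (2003), §6.1 (Props. 18–20, Cor. 1), §6.2 (ρ, Prop. 21). [Jozsa2003]
* M. J. Jacobson, Jr., H. C. Williams, *Solving the Pell Equation*, Springer (2009), §5.1
  ((5.4)–(5.5), Thm. 5.9), §5.2. [JacobsonWilliams2008]
-/

noncomputable section

open scoped Classical

namespace Literature.NumberTheory.QuadraticFields

namespace QuadIrr

variable {D : ℕ}

/-! ### The module `ℤ + φℤ` -/

/-- Jozsa's fractional ideal `J(x) = ℤ + φℤ ⊂ ℝ` of the quotient `x`, `φ = val x`.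
[cite: Jozsa2003, §6.1 (the ideal ℤ + ((b+√D)/2a)ℤ, Prop. 18)] -/
def jmod (x : QuadIrr D) : AddSubgroup ℝ := AddSubgroup.closure {1, x.val}

/-- Membership in `J(x)`: `t = m + nφ`. [cite: Jozsa2003, §6.1 Prop. 18] -/
theorem mem_jmod_iff {x : QuadIrr D} {t : ℝ} : t ∈ jmod x ↔ ∃ m n : ℤ, t = m + n * x.val := by
  unfold jmod
  rw [AddSubgroup.mem_closure_pair]
  constructor
  · rintro ⟨m, n, h⟩
    exact ⟨m, n, by rw [← h]; simp [zsmul_eq_mul]⟩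
  · rintro ⟨m, n, h⟩
    exact ⟨m, n, by rw [h]; simp [zsmul_eq_mul]⟩

/-- `m + nφ ∈ J(x)`. [cite: Jozsa2003, §6.1 Prop. 18] -/
theorem intCast_add_mul_val_mem_jmod (x : QuadIrr D) (m n : ℤ) : (m : ℝ) + n * x.val ∈ jmod x :=
  mem_jmod_iff.mpr ⟨m, n, rfl⟩

/-! ### Steps with an arbitrary quotient -/

/-- The continued-fraction step with quotient `q`: `P' = qQ − P`, `Q' = (D − P'²)/Q`.
[cite: JacobsonWilliams2008, §3.1 (3.2), (3.11) (any sequence of integers q_i)] -/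
def stepWith (x : QuadIrr D) (q : ℤ) : QuadIrr D :=
  ⟨q * x.Q - x.P, ((D : ℤ) - (q * x.Q - x.P) ^ 2) / x.Q⟩

/-- The simple-continued-fraction step is the step with quotient `⌊φ⌋`. [cite: JacobsonWilliams2008, §3.2 (q_i = ⌊φ_i⌋)] -/
theorem step_eq_stepWith (x : QuadIrr D) : step x = stepWith x x.pq := rfl

/-- `P' = qQ − P`. [cite: JacobsonWilliams2008, §3.1 (3.11)] -/
@[simp] theorem stepWith_P (x : QuadIrr D) (q : ℤ) : (stepWith x q).P = q * x.Q - x.P := rfl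

/-- `Q ∣ D − P'²`. [cite: JacobsonWilliams2008, §3.1 (3.11)] -/
theorem dvd_sub_stepWith_P_sq {x : QuadIrr D} (h : x.IsAdmissible) (q : ℤ) :
    x.Q ∣ (D : ℤ) - (stepWith x q).P ^ 2 := by
  rw [stepWith_P]
  have : (D : ℤ) - (q * x.Q - x.P) ^ 2 = ((D : ℤ) - x.P ^ 2) - x.Q * (q ^ 2 * x.Q - 2 * q * x.P) := by ring
  rw [this]
  exact dvd_sub h.2 (dvd_mul_right _ _)

/-- `Q' Q = D − P'²`. [cite: JacobsonWilliams2008, §3.1 (3.11)] -/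
theorem stepWith_Q_mul_Q {x : QuadIrr D} (h : x.IsAdmissible) (q : ℤ) :
    (stepWith x q).Q * x.Q = (D : ℤ) - (stepWith x q).P ^ 2 :=
  Int.ediv_mul_cancel (dvd_sub_stepWith_P_sq h q)

/-- A step with any quotient of admissible data is admissible. [cite: JacobsonWilliams2008, §3.1 (after (3.11))] -/
theorem isAdmissible_stepWith (hD : ¬ IsSquare D) {x : QuadIrr D} (h : x.IsAdmissible) (q : ℤ) :
    (stepWith x q).IsAdmissible := by
  refine ⟨fun h0 => ?_, ⟨x.Q, ?_⟩⟩
  · have := stepWith_Q_mul_Q h q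
    rw [h0, zero_mul] at this
    exact sub_sq_ne_zero hD _ this.symm
  · rw [← stepWith_Q_mul_Q h q]

/-- **`φ' = 1/(φ − q)`** for the step with quotient `q`. [cite: JacobsonWilliams2008, §3.1 (3.2)] -/
theorem val_stepWith (hD : ¬ IsSquare D) {x : QuadIrr D} (h : x.IsAdmissible) (q : ℤ) :
    (stepWith x q).val = 1 / (x.val - q) := by
  have hQ : (x.Q : ℝ) ≠ 0 := by exact_mod_cast h.1
  have hsub : x.val - q = (Real.sqrt D - (stepWith x q).P) / x.Q := by
    rw [stepWith_P]; unfold val; push_cast; field_simp; ring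
  rw [hsub, one_div_div]
  have hmul : ((stepWith x q).Q : ℝ) * x.Q = D - ((stepWith x q).P : ℝ) ^ 2 := by
    exact_mod_cast stepWith_Q_mul_Q h q
  have hne : Real.sqrt D - ((stepWith x q).P : ℝ) ≠ 0 := sub_ne_zero.mpr (sqrt_ne_intCast hD _)
  have hQ' : ((stepWith x q).Q : ℝ) ≠ 0 := by exact_mod_cast (isAdmissible_stepWith hD h q).1
  unfold val
  rw [div_eq_div_iff hQ' hne]
  linear_combination sqrt_sq (D := D) - hmul

/-- `φ' φ = qφ' + 1`. [cite: JacobsonWilliams2008, §3.1 (3.2)] -/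
theorem val_stepWith_mul_val (hD : ¬ IsSquare D) {x : QuadIrr D} (h : x.IsAdmissible) (q : ℤ) :
    (stepWith x q).val * x.val = q * (stepWith x q).val + 1 := by
  rw [val_stepWith hD h q]
  have : x.val - q ≠ 0 := sub_ne_zero.mpr ((irrational_val hD h.1).ne_int _)
  field_simp
  ring

/-- `φ' ≠ 0`. [folklore] -/
theorem val_stepWith_ne_zero (hD : ¬ IsSquare D) {x : QuadIrr D} (h : x.IsAdmissible) (q : ℤ) :
    (stepWith x q).val ≠ 0 := by
  rw [val_stepWith hD h q]
  have : x.val - q ≠ 0 := sub_ne_zero.mpr ((irrational_val hD h.1).ne_int _)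
  exact one_div_ne_zero this

/-- **`J(x') = φ' · J(x)`**: the step multiplies the module by `φ'` (the baby step of the
infrastructure, `ρ(𝔞) = ψ𝔞`). [cite: JacobsonWilliams2008, §5.1 (5.4)–(5.5)] -/
theorem mem_jmod_stepWith_iff (hD : ¬ IsSquare D) {x : QuadIrr D} (h : x.IsAdmissible) (q : ℤ)
    (t : ℝ) : t ∈ jmod (stepWith x q) ↔ ∃ s ∈ jmod x, t = (stepWith x q).val * s := by
  set φ' := (stepWith x q).val with hφ'
  have hkey := val_stepWith_mul_val hD h q
  have hne := val_stepWith_ne_zero hD h q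
  rw [mem_jmod_iff]
  constructor
  · rintro ⟨m, n, rfl⟩
    -- `m + nφ' = φ' · ((n − mq) + m φ)`
    refine ⟨(n - m * q : ℤ) + m * x.val, intCast_add_mul_val_mem_jmod x _ _, ?_⟩
    push_cast
    linear_combination (-(m : ℝ)) * hkey
  · rintro ⟨s, hs, rfl⟩
    obtain ⟨m, n, rfl⟩ := mem_jmod_iff.mp hs
    -- `φ'(m + nφ) = n + (m + nq) φ'`
    refine ⟨n, m + n * q, ?_⟩
    push_cast
    linear_combination (n : ℝ) * hkey

/-! ### Changing the representative: `(P, −Q)` and `(P + kQ, Q)` -/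

/-- `(P, −Q)`: the quotient `−φ`. [folklore] -/
def flipQ (x : QuadIrr D) : QuadIrr D := ⟨x.P, -x.Q⟩

/-- `val (P, −Q) = −φ`. [folklore] -/
theorem val_flipQ (x : QuadIrr D) : (flipQ x).val = -x.val := by
  unfold flipQ val; push_cast; rw [div_neg]

/-- Admissibility is invariant under `Q ↦ −Q`. [folklore] -/
theorem isAdmissible_flipQ {x : QuadIrr D} (h : x.IsAdmissible) : (flipQ x).IsAdmissible :=
  ⟨neg_ne_zero.mpr h.1, (neg_dvd).mpr h.2⟩

/-- `J(P, −Q) = J(P, Q)`. [folklore] -/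
theorem mem_jmod_flipQ_iff (x : QuadIrr D) (t : ℝ) : t ∈ jmod (flipQ x) ↔ t ∈ jmod x := by
  rw [mem_jmod_iff, mem_jmod_iff, val_flipQ]
  constructor
  · rintro ⟨m, n, rfl⟩; exact ⟨m, -n, by push_cast; ring⟩
  · rintro ⟨m, n, rfl⟩; exact ⟨m, -n, by push_cast; ring⟩

/-- `(P + kQ, Q)`: the quotient `φ + k`. [cite: Jozsa2003, §5 (aℤ + (b/2)ℤ = aℤ + (b'/2)ℤ for b' ≡ b mod 2a)] -/
def shiftP (x : QuadIrr D) (k : ℤ) : QuadIrr D := ⟨x.P + k * x.Q, x.Q⟩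

/-- `val (P + kQ, Q) = φ + k`. [cite: Jozsa2003, §5 (property (b))] -/
theorem val_shiftP {x : QuadIrr D} (hQ : x.Q ≠ 0) (k : ℤ) : (shiftP x k).val = x.val + k := by
  have hQ' : (x.Q : ℝ) ≠ 0 := by exact_mod_cast hQ
  unfold shiftP val; push_cast; field_simp; ring

/-- `conj (P + kQ, Q) = φ̄ + k`. [cite: Jozsa2003, §5 (property (b))] -/
theorem conj_shiftP {x : QuadIrr D} (hQ : x.Q ≠ 0) (k : ℤ) : (shiftP x k).conj = x.conj + k := by
  have hQ' : (x.Q : ℝ) ≠ 0 := by exact_mod_cast hQ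
  unfold shiftP conj; push_cast; field_simp; ring

/-- Admissibility is invariant under `P ↦ P + kQ`. [cite: Jozsa2003, §5 Prop. 16] -/
theorem isAdmissible_shiftP {x : QuadIrr D} (h : x.IsAdmissible) (k : ℤ) : (shiftP x k).IsAdmissible := by
  refine ⟨h.1, ?_⟩
  show x.Q ∣ (D : ℤ) - (x.P + k * x.Q) ^ 2
  have : (D : ℤ) - (x.P + k * x.Q) ^ 2 = ((D : ℤ) - x.P ^ 2) - x.Q * (2 * k * x.P + k ^ 2 * x.Q) := by ring
  rw [this]
  exact dvd_sub h.2 (dvd_mul_right _ _)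

/-- `J(P + kQ, Q) = J(P, Q)`. [cite: Jozsa2003, §5 (property (b))] -/
theorem mem_jmod_shiftP_iff {x : QuadIrr D} (hQ : x.Q ≠ 0) (k : ℤ) (t : ℝ) :
    t ∈ jmod (shiftP x k) ↔ t ∈ jmod x := by
  rw [mem_jmod_iff, mem_jmod_iff, val_shiftP hQ]
  constructor
  · rintro ⟨m, n, rfl⟩; exact ⟨m + n * k, n, by push_cast; ring⟩
  · rintro ⟨m, n, rfl⟩; exact ⟨m - n * k, n, by push_cast; ring⟩

/-! ### Normalisation of a small-`Q` quotient to a reduced one -/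

/-- For `Q > 0`, the representative `(P + kQ, Q)` with `√D − Q < P + kQ < √D`.
[cite: JacobsonWilliams2008, §5.1 (proof of Thm. 5.9: β = α + ⌊−ᾱ/|a|⌋|a|)] -/
def normalize (x : QuadIrr D) : QuadIrr D := shiftP x ⌊(Real.sqrt D - x.P) / x.Q⌋

/-- **A quotient with `0 < Q < √D` normalises to a reduced one** (JW Thm. 5.9:
`N(𝔞) < √Δ/2` implies reduced; Jozsa Cor. 1: `a ≤ √D/2`). [cite: JacobsonWilliams2008, §5.1 Thm. 5.9] -/
theorem isReduced_normalize (hD : ¬ IsSquare D) {x : QuadIrr D} (h : x.IsAdmissible) (hQ : 0 < x.Q)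
    (hQD : (x.Q : ℝ) < Real.sqrt D) : (normalize x).IsReduced := by
  set k : ℤ := ⌊(Real.sqrt D - x.P) / x.Q⌋ with hk
  have hQ' : (0 : ℝ) < x.Q := by exact_mod_cast hQ
  have hadm := isAdmissible_shiftP h k
  have h1 : (k : ℝ) ≤ (Real.sqrt D - x.P) / x.Q := Int.floor_le _
  have h2 : (Real.sqrt D - x.P) / x.Q < k + 1 := Int.lt_floor_add_one _
  rw [le_div_iff₀ hQ'] at h1
  rw [div_lt_iff₀ hQ'] at h2
  -- `P' = P + kQ` satisfies `√D − Q < P' < √D` (strictly: `√D` is irrational)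
  have hP'lt : ((x.P + k * x.Q : ℤ) : ℝ) < Real.sqrt D := by
    push_cast
    rcases h1.lt_or_eq with hlt | heq
    · linarith
    · exfalso
      have := sqrt_ne_intCast hD (x.P + k * x.Q)
      push_cast at this
      exact this (by linarith)
  have hP'gt : Real.sqrt D - x.Q < ((x.P + k * x.Q : ℤ) : ℝ) := by push_cast; linarith
  refine ⟨hQ, hadm.2, ?_, ?_, ?_⟩
  · show 1 < (shiftP x k).val
    unfold shiftP val
    rw [lt_div_iff₀ hQ']
    linarith
  · show -1 < (shiftP x k).conj
    unfold shiftP conj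
    rw [lt_div_iff₀ hQ']
    linarith
  · show (shiftP x k).conj < 0
    unfold shiftP conj
    rw [div_neg_iff]
    right; exact ⟨by linarith, hQ'⟩

/-- `J(normalize x) = J(x)`. [cite: JacobsonWilliams2008, §5.1 (proof of Thm. 5.9)] -/
theorem mem_jmod_normalize_iff {x : QuadIrr D} (hQ : x.Q ≠ 0) (t : ℝ) :
    t ∈ jmod (normalize x) ↔ t ∈ jmod x :=
  mem_jmod_shiftP_iff hQ _ t

/-! ### Gauss reduction of a large-`Q` quotient -/

/-- The nearest-integer quotient `q = ⌊(2P + Q)/(2Q)⌋` of a Gauss step (so that `|P'| ≤ Q/2`).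
[cite: Jozsa2003, §6.2 Prop. 21 (reduction with b = τ(b, a), |b| < a when a > √D)] -/
def gaussQuot (x : QuadIrr D) : ℤ := (2 * x.P + x.Q) / (2 * x.Q)

/-- The raw Gauss step (before the sign of `Q'` is fixed). [cite: Jozsa2003, §6.2 Prop. 21] -/
def gaussRaw (x : QuadIrr D) : QuadIrr D := stepWith x (gaussQuot x)

/-- One Gauss step (see `gaussQuot`): the raw step with `Q'` made positive; the identity when
already `Q² < D`. [cite: Jozsa2003, §6.2 Prop. 21] -/
def gaussStep (x : QuadIrr D) : QuadIrr D :=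
  if x.Q ^ 2 < D then x else if 0 < (gaussRaw x).Q then gaussRaw x else flipQ (gaussRaw x)

/-- The nearest-integer quotient leaves `|P'| ≤ Q/2`: `(2P' )² ≤ Q²`. [folklore] -/
theorem sq_gaussRaw_P_le {x : QuadIrr D} (hQ : 0 < x.Q) : 4 * (gaussRaw x).P ^ 2 ≤ x.Q ^ 2 := by
  rw [gaussRaw, stepWith_P, gaussQuot]
  set q := (2 * x.P + x.Q) / (2 * x.Q) with hq
  have h1 := Int.ediv_mul_le (2 * x.P + x.Q) (show 2 * x.Q ≠ 0 by omega)
  have h2 := Int.lt_ediv_add_one_mul_self (2 * x.P + x.Q) (show 0 < 2 * x.Q by omega)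
  rw [← hq] at h1 h2
  have hlo : -x.Q ≤ 2 * (q * x.Q - x.P) := by nlinarith
  have hhi : 2 * (q * x.Q - x.P) ≤ x.Q := by nlinarith
  nlinarith [hlo, hhi, sq_nonneg (2 * (q * x.Q - x.P))]

/-- A Gauss step of admissible data with `Q > 0` is admissible with `Q' > 0`.
[cite: Jozsa2003, §6.2 Prop. 21] -/
theorem gaussStep_spec (hD : ¬ IsSquare D) {x : QuadIrr D} (h : x.IsAdmissible) (hQ : 0 < x.Q) :
    (gaussStep x).IsAdmissible ∧ 0 < (gaussStep x).Q := by
  have hadm : (gaussRaw x).IsAdmissible := isAdmissible_stepWith hD h _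
  unfold gaussStep
  split_ifs with h1 h2
  · exact ⟨h, hQ⟩
  · exact ⟨hadm, h2⟩
  · refine ⟨isAdmissible_flipQ hadm, ?_⟩
    show 0 < -(gaussRaw x).Q
    have := hadm.1
    omega

/-- **For `Q ≥ 2√D` a Gauss step divides `Q` by at least `4`** (`|P'| ≤ Q/2`, so
`|Q'| = |D − P'²|/Q ≤ Q/4`). [cite: Jozsa2003, §6.2 Prop. 21 (a_i < a_{i−1}/2)] -/
theorem four_mul_gaussStep_Q_le {x : QuadIrr D} (h : x.IsAdmissible) (hQ : 0 < x.Q)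
    (hbig : 4 * (D : ℤ) ≤ x.Q ^ 2) : 4 * (gaussStep x).Q ≤ x.Q := by
  have hP := sq_gaussRaw_P_le hQ (x := x)
  have hmul : (gaussRaw x).Q * x.Q = (D : ℤ) - (gaussRaw x).P ^ 2 := stepWith_Q_mul_Q h _
  set y := gaussRaw x with hy
  have hnotlt : ¬ x.Q ^ 2 < D := by
    intro hlt
    have : (D : ℤ) ≤ 4 * D := by omega
    nlinarith
  -- `|Q'| Q = |D − P'²| ≤ Q²/4`
  have key : 4 * |y.Q| * x.Q ≤ x.Q ^ 2 := by
    have e : 4 * |y.Q| * x.Q = 4 * |y.Q * x.Q| := by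
      rw [abs_mul, abs_of_pos hQ]; ring
    rw [e, hmul]
    rcases le_or_gt (y.P ^ 2) (D : ℤ) with hle | hgt
    · rw [abs_of_nonneg (by linarith)]; nlinarith
    · rw [abs_of_neg (by linarith)]; nlinarith
  have key' : 4 * |y.Q| ≤ x.Q := le_of_mul_le_mul_right (by nlinarith [key]) hQ
  unfold gaussStep
  rw [if_neg hnotlt, ← hy]
  split_ifs with h2
  · rw [abs_of_pos h2] at key'; exact key'
  · show 4 * -y.Q ≤ x.Q
    have : |y.Q| = -y.Q := abs_of_nonpos (not_lt.mp h2)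
    rw [this] at key'; exact key'

/-- **For `Q ≥ √D` a Gauss step reaches `Q' < √D`** (`|P'| ≤ Q/2`, so `Q' ≤ max(D/Q, Q/4)`,
and `D/Q ≤ √D`; the step is the identity once `Q² < D`). [cite: Jozsa2003, §6.2 Prop. 21] -/
theorem gaussStep_Q_sq_lt (hD : ¬ IsSquare D) {x : QuadIrr D} (h : x.IsAdmissible) (hQ : 0 < x.Q)
    (hmid : (D : ℤ) ≤ x.Q ^ 2) (hsmall : x.Q ^ 2 < 4 * (D : ℤ)) : (gaussStep x).Q ^ 2 < D := by
  have hP := sq_gaussRaw_P_le hQ (x := x)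
  have hmul : (gaussRaw x).Q * x.Q = (D : ℤ) - (gaussRaw x).P ^ 2 := stepWith_Q_mul_Q h _
  set y := gaussRaw x with hy
  have hne : x.Q ^ 2 ≠ (D : ℤ) := fun heq => sub_sq_ne_zero hD x.Q (by rw [heq, sub_self])
  have hnotlt : ¬ x.Q ^ 2 < D := not_lt.mpr hmid
  -- `|Q'| Q = |D − P'²| < √D · Q`, via `|D − P'²| ≤ max(D, Q²/4) < Q √D`… in squares: `(Q' Q)² < D Q²`
  have key : (y.Q * x.Q) ^ 2 < (D : ℤ) * x.Q ^ 2 := by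
    rw [hmul]
    rcases le_or_gt (y.P ^ 2) (D : ℤ) with hle | hgt
    · -- `0 ≤ D − P'² ≤ D` and `D < Q²` is false… use `D − P'² ≤ D ≤ Q²·D/Q²`: `(D − P'²)² ≤ D² < D Q²`? need `D < Q²`
      have h1 : 0 ≤ (D : ℤ) - y.P ^ 2 := by linarith
      have hDQ : (D : ℤ) < x.Q ^ 2 := lt_of_le_of_ne hmid (Ne.symm hne)
      have hD0 : (0 : ℤ) ≤ D := by positivity
      nlinarith
    · -- `0 < P'² − D ≤ Q²/4 − D < Q²/4`, and `(Q²/4)² < D Q²` iff `Q² < 16 D`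
      have h1 : 0 < y.P ^ 2 - (D : ℤ) := by linarith
      have h2 : 4 * (y.P ^ 2 - (D : ℤ)) < x.Q ^ 2 := by
        have hD0 : (0 : ℤ) < D := by
          rcases Nat.eq_zero_or_pos D with h0 | h0
          · exact absurd ⟨0, by simp [h0]⟩ hD
          · exact_mod_cast h0
        nlinarith
      nlinarith
  have key' : y.Q ^ 2 < D := by
    have hQ2 : 0 < x.Q ^ 2 := by positivity
    have : y.Q ^ 2 * x.Q ^ 2 < (D : ℤ) * x.Q ^ 2 := by rw [← mul_pow]; exact key
    exact lt_of_mul_lt_mul_right this hQ2.le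
  unfold gaussStep
  rw [if_neg hnotlt, ← hy]
  split_ifs with h2
  · exact key'
  · show (-y.Q) ^ 2 < D
    rw [neg_sq]; exact key'

/-- A Gauss step does not change a quotient with `Q² < D`. [folklore] -/
theorem gaussStep_of_sq_lt {x : QuadIrr D} (h : x.Q ^ 2 < D) : gaussStep x = x := by
  unfold gaussStep; rw [if_pos h]

/-- **The module after a Gauss step**: `J(x') = |φ'|·J(x)` for the quotient used — precisely,
`t ∈ J(gaussStep x) ↔ t = (val y) · s` for some `s ∈ J(x)`, where `y` is the underlying step.
[cite: JacobsonWilliams2008, §5.1 (5.4)–(5.5)] -/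
theorem mem_jmod_gaussStep_iff (hD : ¬ IsSquare D) {x : QuadIrr D} (h : x.IsAdmissible) (hx : ¬ x.Q ^ 2 < D)
    (t : ℝ) : t ∈ jmod (gaussStep x) ↔ ∃ s ∈ jmod x, t = (gaussRaw x).val * s := by
  unfold gaussStep
  rw [if_neg hx]
  split_ifs with h2
  · exact mem_jmod_stepWith_iff hD h _ t
  · rw [mem_jmod_flipQ_iff]
    exact mem_jmod_stepWith_iff hD h _ t

/-- The multiplier of a Gauss step is bounded: `1/(2√D + 1)·… ≤ |φ'| ≤ …`; we record the form used
downstream: `|φ'| = Q/|√D − P'|` with `|P'| ≤ Q/2`. Here: `|φ'| · |√D − P'| = Q`.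
[cite: JacobsonWilliams2008, §3.1 (3.2) (φ' = 1/(φ − q) = Q/(√D − P'))] -/
theorem abs_val_stepWith_mul (hD : ¬ IsSquare D) {x : QuadIrr D} (h : x.IsAdmissible) (hQ : 0 < x.Q) (q : ℤ) :
    |(stepWith x q).val| * |Real.sqrt D - (stepWith x q).P| = x.Q := by
  have hQ' : (0 : ℝ) < x.Q := by exact_mod_cast hQ
  have hsub : x.val - q = (Real.sqrt D - (stepWith x q).P) / x.Q := by
    rw [stepWith_P]; unfold val; push_cast; field_simp; ring
  rw [val_stepWith hD h q, hsub, one_div_div, abs_div, abs_of_pos hQ']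
  have hne : Real.sqrt D - ((stepWith x q).P : ℝ) ≠ 0 := sub_ne_zero.mpr (sqrt_ne_intCast hD _)
  field_simp

end QuadIrr

end Literature.NumberTheory.QuadraticFields

end
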